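import Summits.MatrixMultiplication.MatrixMultiplication.Theorems.AbelianSTPPCensusShapeCertSemantics
import Summits.MatrixMultiplication.MatrixMultiplication.Theorems.AbelianSTPPCensusShapeCertVPData
import Summits.MatrixMultiplication.MatrixMultiplication.Theorems.AbelianSTPPCensusShapeCertVPCand

/-!
# Abelian STPP census — the vP certificate checker `ShapeCertVP` for crux `ShapeExclusionVP337` (definitions)

Cell mm-stpp, rung F-M1, route `AbelianSTPPCensusVP` (leaf T_E/337), crux item `ShapeExclusionVP337`
(stmt-MatrixMultiplication-19191; registered stubs `stub_vp_128_207`, `stub_vp_208_337`).  Seat mm-stpp-theory (gen 6).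

`checkV M` is a depth-first search over multisets of member shapes in the style of the lineage-B checker `ShapeCert`
(seat eng-2, crux `ShapeExclusionTE`; we reuse its shape records `Sh`, aggregates `Agg`, hereditary vM admissibility test
`feasP` and continuation-bound arithmetic `Agg.prune`), with four changes for the rule set vP and the orders 128–337:
* integer gains from the extended table `gainV` (`V ≤ 337`);
* rule U11-G ([Gry10] Thm 1.1 through the STPP fibre lemma; tree `U11G`, three letter forms) as a NODE KILL in the
  subtraction-free «credit form»: a shape list is dead at an admissible `t ≥ 3` (`t ≤ P₁`, `t ≤ P₂`, `t ≤ L(t)`) when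
  `t·Σ(ab+bc+ca) > t·M + 2t² − 1 + Σ cr_t`, `cr_t(x) = V_x` if the middle letter of `x` is `< t`, else `t·(product of the
  other two letters)` (`killAt`; the four candidates `lo, hi, v, v+1` of the last segment, exact test at each);
* the GENERALISED GRYNKIEWICZ CONTINUATION BOUND (valid in any scan order): if `(r, t)` is admissible for the prefix then
  every U11-G-alive completion satisfies `Σ_tail ŵ_t ≤ bud := t·M + 2t² − 1 + Σ_prefix cr_t − t·Σ_prefix(ab+bc+ca)` with the
  form-independent weight `ŵ_t(x) = t(ab+bc+ca) − (V if min side < t else t·max pair) ≥ 2t + 1`, hence the tail is empty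
  when `bud ≤ 2t`, and otherwise `Σ_tail gain·K ≤ bud · max_tail ⌈gain·K/ŵ_t⌉` (parameters `t ∈ {5,7,10,14,21,32}`);
* SUFFIX-FREE TABLES: the candidate list is `candTriples` (the 1 889 universe shapes of ratio level `≥ 28`, levels
  descending) filtered by `inUnivB M`; the maxima of `rho` and of the six Grynkiewicz ratios over «all shapes of level
  `≤ L`» are the static tables `tabR` / `tabG` (file `…VPData`, kernel-checked in `…VPTables`), read at the level of the
  current candidate — so no per-order decoration of the universe is computed, shapes of level `≤ 27` are never enumerated
  (they enter only through the tables: the closure test `cl` at the end of each candidate walk), and one order costs the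
  kernel well under 10⁶ reduction steps (the memory ceiling of a kernel-checked declaration on the farm is ≈ 4·10⁶).
Rule U11-P is not used.  No residual lists: a beating admissible prefix makes the check fail.
Soundness (`checkV M = true` ⇒ no `SieveAdmissibleVP`-admissible shape list with ≥ 2 members beats `5/2` at order
`M ≤ 337`) is proved in `…ShapeCertVP{Tables,Semantics,Budgets,Search,Final}`; kernel evaluations in `…ShapeCertVPEval*`.
Validation (seat folder `eng/v2.py`, a Python transcription): verdicts on 128–352 equal the census RECORD (EXCLUDED on
128–337; FEASIBLE exactly at 338–340, 348, 350–352 among the composite orders), ≤ 1.1·10⁴ candidate visits per order ≤ 337.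
-/

set_option linter.dupNamespace false -- `MatrixMultiplication.MatrixMultiplication` (summit = problem, D-0017)
set_option autoImplicit false

namespace Summit.MatrixMultiplication.MatrixMultiplication.Theorems.ShapeCertVP

open ShapeCert

/-! ### Shape records and candidate lists -/

/-- The shape record of `(a,b,c)` at order `M` (fields as `ShapeCert.mkSh`, gain from `gainV`). -/
def mkShV (M a b c : ℕ) : Sh :=
  let g := gainV (a * b * c)
  { a := a, b := b, c := c, V := a * b * c, ab := a * b, bc := b * c, ca := c * a,
    wA := a * (b + c), wB := b * (c + a), wC := c * (a + b), g := g,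
    mpp := max (a * b) (max (b * c) (c * a)),
    dab := a * b * c - a * b + (if hasLCD (a * b * c) M c then 0 else 1),
    dbc := a * b * c - b * c + (if hasLCD (a * b * c) M a then 0 else 1),
    dca := a * b * c - c * a + (if hasLCD (a * b * c) M b then 0 else 1),
    rho := g * K / (a * b + b * c + c * a) + 1,
    lev := min 63 (g * 64 / ((a * b + b * c + c * a) * D)) }

/-- The shape record of a triple. -/
def shV (M : ℕ) (x : ℕ × ℕ × ℕ) : Sh := mkShV M x.1 x.2.1 x.2.2

/-- The universe of member shapes at order `M` with first side `a = a' + 1`, `a' ∈ [lo, lo + n)` (membership test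
`ShapeCert.inUnivB`), records evaluated — used only by the one-time table and completeness checks at order 337
(`…VPTables`, slice by slice), never by `checkV`. -/
def univ0S (M lo n : ℕ) : List Sh :=
  (List.range' lo n).flatMap fun a' => (List.range (M / (a' + 1))).flatMap fun b' =>
    (List.range (M / ((a' + 1) * (b' + 1)))).filterMap fun c' =>
      if inUnivB M (a' + 1) (b' + 1) (c' + 1) then (mkShV M (a' + 1) (b' + 1) (c' + 1)).force some else none

/-- The candidate list at order `M`: the tabled triples (level `≥ 28`, levels descending) that are universe members at
order `M`, as evaluated records. -/
def candV (M : ℕ) : List Sh :=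
  candTriples.filterMap fun x =>
    if inUnivB M x.1 x.2.1 x.2.2 then (mkShV M x.1 x.2.1 x.2.2).force some else none

/-! ### The Grynkiewicz weights -/

/-- The six budget parameters `t`, by index. -/
def tOf : ℕ → ℕ
  | 0 => 5 | 1 => 7 | 2 => 10 | 3 => 14 | 4 => 21 | _ => 32

/-- Form-independent lower weight `ŵ_t(x) = t(ab+bc+ca) − (V if min(a,b,c) < t else t·max pair product)`; at least `2t + 1`,
and below the U11-G weight of `x` in every letter form. -/
def wh (t : ℕ) (s : Sh) : ℕ :=
  t * (s.ab + s.bc + s.ca) - (if min s.a (min s.b s.c) < t then s.V else t * s.mpp)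

/-- Scaled gain/weight ratio `⌊g·K/ŵ_t⌋ + 1`. -/
def qh (t : ℕ) (s : Sh) : ℕ := s.g * K / wh t s + 1

/-! ### Letter forms of rule U11-G on a prefix

Form `r = 0` is form B (letters `(a,b,c)`, middle letter `b`), `r = 1` form A (letters `(c,a,b)`, middle `a`),
`r = 2` form C (letters `(b,c,a)`, middle `c`), as in the tree's `U11G`. -/

/-- the middle letter of `s` in form `r` -/
def midOf : ℕ → Sh → ℕ
  | 0, s => s.b | 1, s => s.a | _, s => s.c
/-- the product of the two non-middle letters -/
def xzOf : ℕ → Sh → ℕ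
  | 0, s => s.ca | 1, s => s.bc | _, s => s.ab
/-- the smaller of the two non-middle letters -/
def mnxzOf : ℕ → Sh → ℕ
  | 0, s => min s.a s.c | 1, s => min s.c s.b | _, s => min s.b s.a
/-- `P₁` of the form (sum of the products first·middle letter), from the aggregates -/
def P1Of : ℕ → Agg → ℕ
  | 0, A => A.sab | 1, A => A.sca | _, A => A.sbc
/-- `P₂` of the form (sum of the products middle·last letter), from the aggregates -/
def P2Of : ℕ → Agg → ℕ
  | 0, A => A.sbc | 1, A => A.sab | _, A => A.sca
/-- `Σ (ab + bc + ca)` from the aggregates -/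
def uuA (A : Agg) : ℕ := A.sab + A.sbc + A.sca

/-- fibre sum `L_r(t) = Σ_{mid < t} mid · min(other two letters)` of a prefix -/
def fibL (r t : ℕ) (f : List Sh) : ℕ := (f.map fun s => if midOf r s < t then midOf r s * mnxzOf r s else 0).sum
/-- credit `Σ cr_t`, `cr_t(x) = V_x` if `mid < t` else `t · (product of the other two letters)` -/
def crS (r t : ℕ) (f : List Sh) : ℕ := (f.map fun s => if midOf r s < t then s.V else t * xzOf r s).sum
/-- the largest middle letter of a prefix -/
def mxMid (r : ℕ) (f : List Sh) : ℕ := (f.map (midOf r)).foldr max 0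

/-- `(r, t)` is admissible for the prefix: `3 ≤ t ≤ min(P₁, P₂)` and `t ≤ L_r(t)` -/
def admRT (r t : ℕ) (A : Agg) (f : List Sh) : Bool :=
  decide (3 ≤ t) && decide (t ≤ P1Of r A) && decide (t ≤ P2Of r A) && decide (t ≤ fibL r t f)

/-- U11-G kill of the prefix `f` (aggregates `A`) in form `r` at `t`: admissible and `t·Σuu > t·M + 2t² − 1 + Σ cr_t`. -/
def killAt (M r t : ℕ) (A : Agg) (f : List Sh) : Bool :=
  admRT r t A f && decide (t * M + 2 * (t * t) - 1 + crS r t f < t * uuA A)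

/-- U11-G kill test in form `r`: the exact test at the four candidates `lo, hi, v, v + 1` of the last segment. -/
def killForm (M r : ℕ) (A : Agg) (f : List Sh) : Bool :=
  seqN (mxMid r f + 1) fun lo => seqN (min (P1Of r A) (min (P2Of r A) (fibL r lo f))) fun hi =>
  seqN ((uuA A - M) / 4) fun v =>
    killAt M r (max lo 3) A f || killAt M r hi A f || killAt M r v A f || killAt M r (v + 1) A f

/-- U11-G kill test of a prefix (three forms), gated by the exact prefilter «`U > M` and `(U − M)² > 8 (min Pᵢ − 4)`». -/
def killV (M : ℕ) (A : Agg) (f : List Sh) : Bool :=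
  seqN (uuA A) fun U =>
    decide (M < U) && decide (8 * (min A.sab (min A.sbc A.sca) - 4) < (U - M) * (U - M)) &&
      (killForm M 0 A f || killForm M 1 A f || killForm M 2 A f)

/-! ### The Grynkiewicz budgets at a node -/

/-- budget of form `r` at `t` for the prefix (`none` unless admissible): `t·M + 2t² − 1 + Σ cr_t − t·Σuu` (truncated). -/
def budRT (M r t : ℕ) (A : Agg) (f : List Sh) : Option ℕ :=
  if admRT r t A f then some (t * M + 2 * (t * t) - 1 + crS r t f - t * uuA A) else none

/-- the smaller of two optional budgets -/
def omin : Option ℕ → Option ℕ → Option ℕ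
  | none, y => y
  | some x, none => some x
  | some x, some y => some (min x y)

/-- budget at `t`: the least budget over the admissible forms -/
def budT (M t : ℕ) (A : Agg) (f : List Sh) : Option ℕ :=
  omin (budRT M 0 t A f) (omin (budRT M 1 t A f) (budRT M 2 t A f))

/-- The six optional budgets of a node (index `i` for `t = tOf i`). -/
structure Buds where
  (b0 b1 b2 b3 b4 b5 : Option ℕ)

/-- component `i` (`i ≥ 5` reads the last) -/
def Buds.get (B : Buds) : ℕ → Option ℕ
  | 0 => B.b0 | 1 => B.b1 | 2 => B.b2 | 3 => B.b3 | 4 => B.b4 | _ => B.b5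

/-- the budgets of a prefix -/
def budsOf (M : ℕ) (A : Agg) (f : List Sh) : Buds :=
  ⟨budT M (tOf 0) A f, budT M (tOf 1) A f, budT M (tOf 2) A f, budT M (tOf 3) A f, budT M (tOf 4) A f, budT M (tOf 5) A f⟩

/-- budget `i` certifies an empty tail: it is at most `2t`, while every tail weight is `≥ 2t + 1` -/
def beEmpty (i : ℕ) : Option ℕ → Bool
  | none => false
  | some b => decide (b ≤ 2 * tOf i)

/-- some budget certifies that no admissible completion adds a member -/
def Buds.tailEmpty (B : Buds) : Bool :=
  beEmpty 0 B.b0 || beEmpty 1 B.b1 || beEmpty 2 B.b2 || beEmpty 3 B.b3 || beEmpty 4 B.b4 || beEmpty 5 B.b5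

/-- budget `i` certifies «prefix gain + tail gain ≤ 10⁶·M» with the level-`L` Grynkiewicz table
(`g0 = K · prefix gain`, `mdk = 10⁶·M·K`) -/
def beCl (g0 mdk L i : ℕ) : Option ℕ → Bool
  | none => false
  | some b => decide (g0 + b * (tabG L).get i ≤ mdk)

/-- some budget closes with table `L` -/
def Buds.clAny (B : Buds) (g0 mdk L : ℕ) : Bool :=
  beCl g0 mdk L 0 B.b0 || beCl g0 mdk L 1 B.b1 || beCl g0 mdk L 2 B.b2 ||
    beCl g0 mdk L 3 B.b3 || beCl g0 mdk L 4 B.b4 || beCl g0 mdk L 5 B.b5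

/-- Selection state of the node bound: `(found, budget, parameter index, value)`. -/
structure GSel where
  (ok : Bool) (bud idx val : ℕ)

/-- keep the better of the current selection and parameter `i` with optional budget (value `budget · (tabG L) i`) -/
def gpick (L : ℕ) (cur : GSel) (i : ℕ) (ob : Option ℕ) : GSel :=
  match ob with
  | none => cur
  | some b =>
    seqN (b * (tabG L).get i) fun v => if cur.ok && decide (cur.val ≤ v) then cur else ⟨true, b, i, v⟩

/-- the node's Grynkiewicz selection for the in-walk break test (table of the node's own level `L`) -/
def gnode (L : ℕ) (B : Buds) : GSel :=
  gpick L (gpick L (gpick L (gpick L (gpick L (gpick L ⟨false, 0, 0, 0⟩ 0 B.b0) 1 B.b1) 2 B.b2) 3 B.b3) 4 B.b4) 5 B.b5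

/-! ### The search -/

/-- One candidate step.  First the cheap first-member test (rule U11 per member at the candidate itself bounds the
packing weight of every completion by `(3M + a + b + c)/2`, its ratio by the candidate's table row), then the continuation
bound of the extended prefix (`Agg.prune` with the candidate's table row), admissibility (`feasP`), the U11-G kill, and the
recursion. -/
def stepV (M : ℕ) (rec : List Sh → List Sh → Bool) (t : Sh) (A : Agg) (fam : List Sh) (g0 q : ℕ) (sel : B8 → ℕ)
    (mdk : ℕ) (rest : List Sh) : Bool :=
  if g0 + t.g * K + sel (tabR t.lev) * min q ((3 * M + (t.a + t.b + t.c)) / 2 - uuA A - (t.ab + t.bc + t.ca)) ≤ mdk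
  then true
  else
    (A.push t).force fun P =>
      if P.prune M (tabR t.lev) then true
      else if feasP M P t (!fam.isEmpty) A.mxV A.mxP (t :: fam) then
        (if killV M P (t :: fam) then true else rec (t :: fam) (t :: rest))
      else true

/-- One DFS level (cf. `ShapeCert.loop`).  The candidates come in descending ratio level and the tables are cumulative
by level, so once a candidate's level is below the node's break level `lb1 − 1` (computed once per node by `breakLev`:
the packing-ratio bound or the Grynkiewicz bound with the tables of that level cannot beat) every remaining completion —
by listed or unlisted shapes — is excluded and the walk STOPS; candidates over the U11 budgets or the volume cap are
skipped; the others go through `stepV`; at the end of the list the closure value `cl` (the two bounds with the level-27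
tables, computed by the caller) decides. -/
def loopV (M : ℕ) (rec : List Sh → List Sh → Bool) (fam : List Sh) (A : Agg)
    (ra rb rc vl g0 q : ℕ) (sel : B8 → ℕ) (mdk lb1 : ℕ) (cl : Bool) : List Sh → Bool
  | [] => cl
  | t :: rest =>
    if t.lev < lb1 then true
    else if ra < t.wA ∨ rb < t.wB ∨ rc < t.wC ∨ vl < t.V then loopV M rec fam A ra rb rc vl g0 q sel mdk lb1 cl rest
    else stepV M rec t A fam g0 q sel mdk rest && loopV M rec fam A ra rb rc vl g0 q sel mdk lb1 cl rest

/-- Binary search on the levels `[27, 54]`: one plus the largest level `L` with `p L` (for a downward-closed `p`), or `0`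
if `p 27` fails; `l` is the largest level known to satisfy `p` plus one (initially `27`, unknown), `h` one plus the
largest candidate level; fuel `n`. -/
def bsearch (p : ℕ → Bool) : ℕ → ℕ → ℕ → ℕ
  | 0, l, _ => l
  | n + 1, l, h =>
    if h ≤ l then l
    else
      let mid := (l + h) / 2
      if p mid then bsearch p n (mid + 1) h else bsearch p n l mid

/-- the break level (plus one) of a node: the least level at which neither bound closes, i.e. one plus the largest level
`L ≥ 27` such that the packing ratio bound (`g0 + sel (tabR L) · q ≤ mdk`) or — if `gb` — the Grynkiewicz bound
(`g0 + gB · (tabG L) gi ≤ mdk`) excludes every completion by shapes of level `≤ L`; `0` if there is none -/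
def breakLev (g0 q : ℕ) (sel : B8 → ℕ) (mdk : ℕ) (gb : Bool) (gB gi : ℕ) : ℕ :=
  seqN (bsearch (fun L => decide (g0 + sel (tabR L) * q ≤ mdk)) 6 27 55) fun r =>
  seqN (if gb then bsearch (fun L => decide (g0 + gB * (tabG L).get gi ≤ mdk)) 6 27 55 else 27) fun g =>
    if max r g ≤ 27 then 0 else max r g

/-- the ratio level of the newest member of a prefix (`27`, the floor of the tables, for the empty prefix — unused) -/
def headLev : List Sh → ℕ
  | [] => 27
  | t :: _ => t.lev

/-- The DFS with fuel: a beating prefix refutes the certificate; a dead prefix has no extensions; a prefix whose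
Grynkiewicz budget admits no member, or whose bound cannot beat, is pruned; otherwise walk the candidates (node constants
evaluated once; the root's closure is the static level lemma of `…VPSearch`, so `cl = true` there). -/
def dfsV (M : ℕ) : ℕ → List Sh → List Sh → Bool
  | 0, _, _ => false
  | n + 1, fam, L =>
    (aggOf M fam).force fun A =>
      if M * D < A.gs then false
      else if A.dead M then true
      else
        let Bs := budsOf M A fam
        if Bs.tailEmpty then decide (A.gs ≤ M * D)
        else
          let S := gnode (headLev fam) Bs
          seqN S.bud fun gB => seqN S.idx fun gi =>
            if S.ok && decide (A.gs * K + gB * (tabG (headLev fam)).get gi ≤ M * D * K) then true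
            else
              seqN (A.ra M) fun ra => seqN (A.rb M) fun rb => seqN (A.rc M) fun rc => seqN (A.vl M) fun vl =>
              seqN (A.gs * K) fun g0 => seqN (A.q0 M) fun q => seqN (A.kOf M) fun k => seqN (M * D * K) fun mdk =>
              seqN (breakLev g0 q (selOf k) mdk S.ok gB gi) fun lb1 =>
                let cl := fam.isEmpty || decide (g0 + selOf k (tabR 27) * q ≤ mdk) || Bs.clAny g0 mdk 27
                loopV M (dfsV M n) fam A ra rb rc vl g0 q (selOf k) mdk lb1 cl L

/-- The certificate checker for crux `ShapeExclusionVP337` at order `M`. -/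
def checkV (M : ℕ) : Bool := dfsV M (M + 2) [] (candV M)

/-! ### One-time data checks (evaluated by the kernel in `…VPTables`, at order 337, slice by slice) -/

/-- the static tables dominate the record `s`: `rho ≤ tabR (lev s) k` for every admitting volume bucket `k`, and
`qh_t ≤ tabG (lev s) i` for the six parameters -/
def tabOK (s : Sh) : Bool :=
  (List.range 8).all (fun k => !capOK k s.V || decide (s.rho ≤ (tabR s.lev).get k)) &&
    (List.range 6).all (fun i => decide (qh (tOf i) s ≤ (tabG s.lev).get i))

/-- the record's level is at most `54`, and the record is tabled at its level unless the level is below `28` -/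
def litOK (s : Sh) : Bool := decide (s.lev ≤ 54) && (decide (s.lev < 28) || decide (s.tr ∈ litLev s.lev))

/-- both one-time checks -/
def allOK (s : Sh) : Bool := tabOK s && litOK s

/-! ### Semantic vocabulary (statements only; the theorems are in `…ShapeCertVP{Semantics,…}`)

Triple-level versions of the record fields, the letter forms on triples, rule U11-G in credit form on multisets
(`AdmG`; vP admissibility is `ShapeCert.AdmM ∧ AdmG`), the total gain `gsumV`, well-formed record lists `WfV`, the
standing hypotheses `AboveV` of the search induction and its goal `GoalV`. -/

section trip
/-! #### Triple-level functions -/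
variable (x : ℕ × ℕ × ℕ)

/-- integer gain of a triple -/
def gT : ℕ := gainV (vol x)
/-- scaled gain/packing ratio -/
def rhoT : ℕ := gT x * K / uu x + 1
/-- ratio level -/
def levT : ℕ := min 63 (gT x * 64 / (uu x * D))
/-- the smallest side -/
def mn3 : ℕ := min x.1 (min x.2.1 x.2.2)
/-- form-independent Grynkiewicz weight `ŵ_t` -/
def whT (t : ℕ) : ℕ := t * uu x - (if mn3 x < t then vol x else t * mpp3 x)
/-- scaled gain/weight ratio -/
def qhT (t : ℕ) : ℕ := gT x * K / whT x t + 1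

end trip

section forms
/-! ### Letter forms on triples (form `0` = B, `1` = A, `≥ 2` = C) -/

/-- middle letter -/
def midT : ℕ → ℕ × ℕ × ℕ → ℕ
  | 0, x => x.2.1 | 1, x => x.1 | _, x => x.2.2
/-- product of the two other letters -/
def xzT : ℕ → ℕ × ℕ × ℕ → ℕ
  | 0, x => pca x | 1, x => pbc x | _, x => pab x
/-- the smaller of the two other letters -/
def mnxzT : ℕ → ℕ × ℕ × ℕ → ℕ
  | 0, x => min x.1 x.2.2 | 1, x => min x.2.2 x.2.1 | _, x => min x.2.1 x.1
/-- pair product first·middle -/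
def p1T : ℕ → ℕ × ℕ × ℕ → ℕ
  | 0, x => pab x | 1, x => pca x | _, x => pbc x
/-- pair product middle·last -/
def p2T : ℕ → ℕ × ℕ × ℕ → ℕ
  | 0, x => pbc x | 1, x => pab x | _, x => pca x
/-- credit `cr_t` -/
def crT (r t : ℕ) (x : ℕ × ℕ × ℕ) : ℕ := if midT r x < t then vol x else t * xzT r x
/-- fibre term -/
def fibT (r t : ℕ) (x : ℕ × ℕ × ℕ) : ℕ := if midT r x < t then midT r x * mnxzT r x else 0

end forms

/-- Rule U11-G (three letter forms, credit form) on a multiset of triples at order `M`: for every form `r` and every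
admissible `t ≥ 3`, `t·Σ(ab+bc+ca) + 1 ≤ t·M + 2t² + Σ cr_t`. -/
def AdmG (M : ℕ) (G : Multiset (ℕ × ℕ × ℕ)) : Prop :=
  ∀ r t : ℕ, 3 ≤ t → t ≤ (G.map (p1T r)).sum → t ≤ (G.map (p2T r)).sum → t ≤ (G.map (fibT r t)).sum →
    t * (G.map uu).sum + 1 ≤ t * M + 2 * (t * t) + (G.map (crT r t)).sum

/-- total integer gain of a shape multiset (extended table) -/
def gsumV (G : Multiset (ℕ × ℕ × ℕ)) : ℕ := (G.map gT).sum

/-- every record of the list is the record of its own triple -/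
def WfV (M : ℕ) (l : List Sh) : Prop := ∀ t ∈ l, t = shV M t.tr

/-- Standing hypotheses of the search induction: an admissible family `G` inside the universe of order `M ≤ 337`, above
the well-formed prefix `fam`. -/
structure AboveV (M : ℕ) (G : Multiset (ℕ × ℕ × ℕ)) (fam : List Sh) : Prop where
  hM : M ≤ 337
  univ : ∀ x ∈ G, InUniv M x
  adm : AdmM M G
  admG : AdmG M G
  wf : WfV M fam
  le : famT fam ≤ G

/-- What the search below the prefix `fam` with remaining candidate list `R` guarantees: no admissible family above
the prefix beats, provided every tail member is listed in `R` or has ratio level `≤ 27`. -/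
def GoalV (M : ℕ) (fam R : List Sh) : Prop :=
  ∀ G : Multiset (ℕ × ℕ × ℕ), AboveV M G fam → M * D < gsumV G →
    (∀ x ∈ G - famT fam, levT x ≤ 27 ∨ shV M x ∈ R) → False

/-- Side conditions on a candidate list: well-formed records inside the universe, levels non-increasing. -/
structure PoolOK (M : ℕ) (R : List Sh) : Prop where
  wf : WfV M R
  univ : ∀ t ∈ R, InUniv M t.tr
  sorted : R.Pairwise (fun s t => t.lev ≤ s.lev)

end Summit.MatrixMultiplication.MatrixMultiplication.Theorems.ShapeCertVP
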